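import Mathlib
import Summits.Ventures.PercRepro2.Defs
import Summits.Ventures.PercRepro2.Independence
import Summits.Ventures.PercRepro2.Harris
import Summits.Ventures.PercRepro2.Graph

/-!
# RED-FAVOUR: forcing red and demanding red-joinedness tilts the p–q balance towards red
(blind cell PercRepro2, p2 g12; paper proof proofs/P2-G12-NONFULL.md §2)

Two-colourings of a finite multigraph: a configuration `ω : Config E` is read as the RED edge
set (`ω e = true` = red), its complement `flip ω` as the BLUE edge set; the product weight `p`
is the red-probability vector.  For marks `p q : V` and a vertex set `W` we compare

* `Y ∩ Zᶜ ∩ E_W` — `p` and `q` blue-connected, red-disconnected, every `w ∈ W` red-joined to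
  `p` or `q`, with
* `Yᶜ ∩ Z ∩ E_W` — `p` and `q` red-connected, blue-disconnected, every `w ∈ W` red-joined.

**Theorem `prob_blue_red_le_prob_red_blue`**: if every red-probability is at least its blue
probability (`1 - p e ≤ p e`), the first event is at most as likely as the second.  Forced-red
edges are the weights `p e = 1`; at `p ≡ 1/2` and `W = ∅` the two sides are equal by the colour
reflection, so the theorem says that forcing red edges and requiring red-joinedness can only help
the red side.

Proof (four steps, the classical toolbox): `A := Y ∩ Zᶜ` is a lower set (decreasing in red) and
`E_W` an upper set; Harris (mixed form) gives `P_p(A ∩ E_W) ≤ P_p(A) P_p(E_W)`; the weights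
`p` dominate the reflected weights `1 - p`, so `P_p(A) ≤ P_{1-p}(A)` (a lower set); the colour
reflection identifies `P_p(E_W)` with `P_{1-p}(flip⁻¹ E_W)`, a lower set; Harris for two lower
sets gives `P_{1-p}(A) P_{1-p}(flip⁻¹ E_W) ≤ P_{1-p}(A ∩ flip⁻¹ E_W)`, and reflecting back,
`P_{1-p}(A ∩ flip⁻¹ E_W) = P_p(Yᶜ ∩ Z ∩ E_W)`.
-/

namespace Summit.Ventures.PercRepro2

namespace RedFavour

section Flip

variable {E : Type*}

/-- The colour reflection of a configuration: every edge changes colour. -/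
def flip (ω : Config E) : Config E := fun e => !ω e

/-- `flip` at an edge. -/
@[simp] lemma flip_apply (ω : Config E) (e : E) : flip ω e = !ω e := rfl

/-- `flip` is an involution. -/
lemma flip_flip (ω : Config E) : flip (flip ω) = ω := by
  funext e; simp [flip]

/-- `flip` is an involution (as a `Function.Involutive`). -/
lemma flip_involutive : Function.Involutive (flip : Config E → Config E) := flip_flip

/-- The colour reflection as a permutation of the configurations. -/
def flipEquiv : Equiv.Perm (Config E) := flip_involutive.toPerm

/-- `flipEquiv` acts as `flip`. -/
@[simp] lemma flipEquiv_apply (ω : Config E) : flipEquiv ω = flip ω := rfl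

/-- `flip` reverses the configuration order. -/
lemma flip_antitone : Antitone (flip : Config E → Config E) := by
  intro ω ω' h e
  have he := h e
  simp only [flip_apply]
  rw [Bool.le_iff_imp] at he ⊢
  revert he
  generalize ω e = a
  generalize ω' e = b
  cases a <;> cases b <;> simp

/-- The preimage under `flip` of an increasing event is a decreasing event. -/
lemma isLowerSet_preimage_flip {A : Set (Config E)} (hA : IsUpperSet A) :
    IsLowerSet (flip ⁻¹' A) := fun _ _ hle hω => hA (flip_antitone hle) hω

/-- The preimage under `flip` of a decreasing event is an increasing event. -/
lemma isUpperSet_preimage_flip {A : Set (Config E)} (hA : IsLowerSet A) :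
    IsUpperSet (flip ⁻¹' A) := fun _ _ hle hω => hA (flip_antitone hle) hω

/-- `flip ⁻¹' (flip ⁻¹' A) = A`. -/
lemma preimage_flip_flip (A : Set (Config E)) : flip ⁻¹' (flip ⁻¹' A) = A := by
  ext ω; simp [flip_flip]

end Flip

section Pbar

variable {E : Type*} {R : Type*} [CommRing R]

/-- The reflected weight vector: blue-probabilities `1 - p e`. -/
def pbar (p : E → R) : E → R := fun e => 1 - p e

/-- `pbar` at an edge. -/
@[simp] lemma pbar_apply (p : E → R) (e : E) : pbar p e = 1 - p e := rfl

/-- `pbar` is an involution. -/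
lemma pbar_pbar (p : E → R) : pbar (pbar p) = p := by
  funext e; simp [pbar]

end Pbar

section Weights

variable {E : Type*} [Fintype E] [DecidableEq E] {R : Type*} [CommRing R]

omit [DecidableEq E] in
/-- The weight of the reflected configuration under `p` is the weight of the configuration
under the reflected weights. -/
lemma weight_flip (p : E → R) (ω : Config E) : weight p (flip ω) = weight (pbar p) ω := by
  unfold weight
  refine Finset.prod_congr rfl fun e _ => ?_
  simp only [flip_apply, pbar_apply]
  generalize ω e = b
  cases b <;> simp [edgeFactor]

/-- Reflection identity for probabilities: `P_p(flip⁻¹ A) = P_{1-p}(A)`. -/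
lemma prob_preimage_flip (p : E → R) (A : Set (Config E)) :
    prob p (flip ⁻¹' A) = prob (pbar p) A := by
  unfold prob
  rw [← Equiv.sum_comp (flipEquiv : Equiv.Perm (Config E))]
  refine Finset.sum_congr rfl fun ω _ => ?_
  simp only [flipEquiv_apply]
  by_cases h : ω ∈ A
  · have h' : flip ω ∈ flip ⁻¹' A := by simpa [Set.mem_preimage, flip_flip] using h
    rw [Set.indicator_of_mem h', Set.indicator_of_mem h, weight_flip]
  · have h' : flip ω ∉ flip ⁻¹' A := by simpa [Set.mem_preimage, flip_flip] using h
    rw [Set.indicator_of_notMem h', Set.indicator_of_notMem h]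

end Weights

section Mix

variable {E : Type*} [DecidableEq E] {R : Type*}

/-- Mixing two weight vectors along a finite set of edges. -/
def mix (F : Finset E) (p p' : E → R) : E → R := fun e => if e ∈ F then p' e else p e

/-- Inserting an edge into the mixing set is a single-coordinate update. -/
lemma mix_insert (F : Finset E) (p p' : E → R) (e : E) :
    mix (insert e F) p p' = Function.update (mix F p p') e (p' e) := by
  funext e'
  by_cases h : e' = e
  · subst h; simp [mix]
  · simp [mix, h]

end Mix

section Monotone

variable {E : Type*} [Fintype E] [DecidableEq E] {R : Type*} [CommRing R] [PartialOrder R]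
  [IsOrderedRing R]

omit [Fintype E] [DecidableEq E] in
/-- The reflected weights of an admissible vector are admissible. -/
lemma isProbVec_pbar {p : E → R} (hp : IsProbVec p) : IsProbVec (pbar p) :=
  ⟨fun e => by simpa using hp.le_one e, fun e => by simpa using hp.nonneg e⟩

omit [Fintype E] [IsOrderedRing R] in
/-- A mix of admissible weight vectors is admissible. -/
lemma isProbVec_mix (F : Finset E) {p p' : E → R} (hp : IsProbVec p) (hp' : IsProbVec p') :
    IsProbVec (mix F p p') := by
  refine ⟨fun e => ?_, fun e => ?_⟩ <;> unfold mix <;> split_ifs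
  · exact hp'.nonneg e
  · exact hp.nonneg e
  · exact hp'.le_one e
  · exact hp.le_one e

/-- One step of the monotone coupling: raising one coordinate of the weights raises the
expectation of a monotone observable. -/
lemma expect_mix_le_expect_mix_insert (F : Finset E) {p p' : E → R} (hp : IsProbVec p)
    (hp' : IsProbVec p') (hle : p ≤ p') {f : Config E → R} (hf : Monotone f) (e : E) :
    expect (mix F p p') f ≤ expect (mix (insert e F) p p') f := by
  by_cases heF : e ∈ F
  · rw [Finset.insert_eq_of_mem heF]
  have hE : expect (mix (insert e F) p p') f =
      p' e * expect (Function.update (mix F p p') e 1) f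
        + (1 - p' e) * expect (Function.update (mix F p p') e 0) f := by
    rw [mix_insert, expect_eq_pin _ f e]
    simp only [Function.update_self, Function.update_idem]
  have hE' : expect (mix F p p') f =
      p e * expect (Function.update (mix F p p') e 1) f
        + (1 - p e) * expect (Function.update (mix F p p') e 0) f := by
    rw [expect_eq_pin _ f e]
    simp [mix, heF]
  rw [hE, hE']
  have h01 := expect_update_zero_le_expect_update_one (isProbVec_mix F hp hp') hf e
  have hpe := hle e
  have hprod := mul_nonneg (sub_nonneg.2 hpe) (sub_nonneg.2 h01)
  rw [← sub_nonneg]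
  have key : p' e * expect (Function.update (mix F p p') e 1) f
        + (1 - p' e) * expect (Function.update (mix F p p') e 0) f
      - (p e * expect (Function.update (mix F p p') e 1) f
        + (1 - p e) * expect (Function.update (mix F p p') e 0) f)
      = (p' e - p e) * (expect (Function.update (mix F p p') e 1) f
        - expect (Function.update (mix F p p') e 0) f) := by ring
  rw [key]
  exact hprod

/-- Monotone coupling: the expectation of a monotone observable is monotone in the weights. -/
theorem expect_le_expect_of_le {p p' : E → R} (hp : IsProbVec p) (hp' : IsProbVec p')
    (hle : p ≤ p') {f : Config E → R} (hf : Monotone f) : expect p f ≤ expect p' f := by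
  have key : ∀ F : Finset E, expect p f ≤ expect (mix F p p') f := by
    intro F
    induction F using Finset.induction_on with
    | empty =>
      have : mix ∅ p p' = p := by funext e; simp [mix]
      rw [this]
    | insert e F heF ih =>
      exact ih.trans (expect_mix_le_expect_mix_insert F hp hp' hle hf e)
  have : mix Finset.univ p p' = p' := by funext e; simp [mix]
  simpa [this] using key Finset.univ

/-- Monotone coupling for increasing events: `P_p(A) ≤ P_{p'}(A)` when `p ≤ p'`. -/
theorem prob_le_prob_of_le_of_isUpperSet {p p' : E → R} (hp : IsProbVec p) (hp' : IsProbVec p')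
    (hle : p ≤ p') {A : Set (Config E)} (hA : IsUpperSet A) : prob p A ≤ prob p' A := by
  rw [prob_eq_expect_indicator, prob_eq_expect_indicator]
  exact expect_le_expect_of_le hp hp' hle (monotone_indicator_of_isUpperSet (R := R) hA)

/-- Monotone coupling for decreasing events: `P_{p'}(A) ≤ P_p(A)` when `p ≤ p'`. -/
theorem prob_le_prob_of_le_of_isLowerSet {p p' : E → R} (hp : IsProbVec p) (hp' : IsProbVec p')
    (hle : p ≤ p') {A : Set (Config E)} (hA : IsLowerSet A) : prob p' A ≤ prob p A := by
  have h := prob_le_prob_of_le_of_isUpperSet hp hp' hle hA.compl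
  rw [prob_compl, prob_compl] at h
  exact (sub_le_sub_iff_left (1 : R)).1 h

end Monotone

section Events

variable {V : Type*} {E : Type*}

/-- `p` and `q` are RED-connected (connected in the configuration `ω`). -/
def redConn (ends : E → Sym2 V) (p q : V) : Set (Config E) := connEvent ends p q

/-- `p` and `q` are BLUE-connected (connected in the reflected configuration). -/
def blueConn (ends : E → Sym2 V) (p q : V) : Set (Config E) := flip ⁻¹' connEvent ends p q

/-- Every vertex of `W` is red-joined to `p` or to `q`. -/
def redJoined (ends : E → Sym2 V) (p q : V) (W : Set V) : Set (Config E) :=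
  {ω | ∀ w ∈ W, Conn ends ω p w ∨ Conn ends ω q w}

/-- `redConn` is increasing in the red set. -/
lemma isUpperSet_redConn (ends : E → Sym2 V) (p q : V) : IsUpperSet (redConn ends p q) :=
  isUpperSet_connEvent ends p q

/-- `blueConn` is decreasing in the red set. -/
lemma isLowerSet_blueConn (ends : E → Sym2 V) (p q : V) : IsLowerSet (blueConn ends p q) :=
  isLowerSet_preimage_flip (isUpperSet_connEvent ends p q)

/-- `redJoined` is increasing in the red set. -/
lemma isUpperSet_redJoined (ends : E → Sym2 V) (p q : V) (W : Set V) :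
    IsUpperSet (redJoined ends p q W) := by
  intro ω ω' hle hω w hw
  rcases hω w hw with h | h
  · exact Or.inl (conn_mono hle h)
  · exact Or.inr (conn_mono hle h)

/-- The reflection exchanges the two colours of the `p`–`q` connection events. -/
lemma preimage_flip_blue_red (ends : E → Sym2 V) (p q : V) :
    flip ⁻¹' (blueConn ends p q ∩ (redConn ends p q)ᶜ) =
      redConn ends p q ∩ (blueConn ends p q)ᶜ := by
  unfold blueConn redConn
  rw [Set.preimage_inter, Set.preimage_compl, preimage_flip_flip]

end Events

section Theorem

variable {V : Type*} {E : Type*} [Fintype E] [DecidableEq E] {R : Type*} [CommRing R]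
  [PartialOrder R] [IsStrictOrderedRing R]

/-- **RED-FAVOUR.** If every edge is at least as likely red as blue (`1 - p e ≤ p e`), then for
every vertex set `W`: «`p`, `q` blue-connected and red-disconnected, `W` red-joined» is at most as
likely as «`p`, `q` red-connected and blue-disconnected, `W` red-joined». -/
theorem prob_blue_red_le_prob_red_blue (ends : E → Sym2 V) (p q : V) (W : Set V)
    {wt : E → R} (hwt : IsProbVec wt) (hhalf : ∀ e, 1 - wt e ≤ wt e) :
    prob wt (blueConn ends p q ∩ (redConn ends p q)ᶜ ∩ redJoined ends p q W) ≤
      prob wt (redConn ends p q ∩ (blueConn ends p q)ᶜ ∩ redJoined ends p q W) := by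
  set A := blueConn ends p q ∩ (redConn ends p q)ᶜ with hAdef
  set EW := redJoined ends p q W with hEWdef
  have hA : IsLowerSet A := (isLowerSet_blueConn ends p q).inter (isUpperSet_redConn ends p q).compl
  have hEW : IsUpperSet EW := isUpperSet_redJoined ends p q W
  have hbar : IsProbVec (pbar wt) := isProbVec_pbar hwt
  have hle : pbar wt ≤ wt := fun e => hhalf e
  -- (1) Harris, mixed form
  have h1 : prob wt (A ∩ EW) ≤ prob wt A * prob wt EW :=
    prob_inter_le_prob_mul_prob_of_isLowerSet hwt hA hEW
  -- (2) monotone coupling for the lower set `A`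
  have h2 : prob wt A ≤ prob (pbar wt) A := prob_le_prob_of_le_of_isLowerSet hbar hwt hle hA
  -- (3) reflection of `EW`
  have h3 : prob wt EW = prob (pbar wt) (flip ⁻¹' EW) := by
    rw [prob_preimage_flip, pbar_pbar]
  -- (4) Harris for two lower sets under the reflected weights
  have h4 : prob (pbar wt) A * prob (pbar wt) (flip ⁻¹' EW) ≤ prob (pbar wt) (A ∩ flip ⁻¹' EW) :=
    prob_mul_prob_le_prob_inter_of_isLowerSet hbar hA (isLowerSet_preimage_flip hEW)
  -- (5) reflecting back
  have h5 : prob (pbar wt) (A ∩ flip ⁻¹' EW) =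
      prob wt (redConn ends p q ∩ (blueConn ends p q)ᶜ ∩ EW) := by
    rw [← prob_preimage_flip, Set.preimage_inter, preimage_flip_flip, hAdef,
      preimage_flip_blue_red]
  have hEW0 : 0 ≤ prob wt EW := prob_nonneg hwt EW
  calc prob wt (A ∩ EW) ≤ prob wt A * prob wt EW := h1
    _ ≤ prob (pbar wt) A * prob wt EW := mul_le_mul_of_nonneg_right h2 hEW0
    _ = prob (pbar wt) A * prob (pbar wt) (flip ⁻¹' EW) := by rw [h3]
    _ ≤ prob (pbar wt) (A ∩ flip ⁻¹' EW) := h4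
    _ = prob wt (redConn ends p q ∩ (blueConn ends p q)ᶜ ∩ EW) := h5

end Theorem

end RedFavour

end Summit.Ventures.PercRepro2
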